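import Summits.QuantumFields.BalabanUV.Beta.SymShiftGaugeBlind
import Summits.QuantumFields.BalabanUV.Beta.DshAn1Spread
import Summits.QuantumFields.BalabanUV.Beta.SymBorderedHessianStepBlind

/-!
# `BalabanUV.Beta.SymResolventPseudoInverse` — binder row D1, hR side of the (0.4) ROOT: **THE RESOLVENT OF RECORD IS A GENERALISED INVERSE OF THE
# SHIFTED SPREAD — `𝕄_j ∘ G_j ∘ 𝕄_j = 𝕄_j`** for `𝕄_j := bhKStepSh d Lc (Dsh Lc) j = bhKStep d Lc j + stepScale j • Dsh Lc`, `G_j := Gsym Lc j`, every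
# level `j` (brick «N7g-bis», an3's S-an3-g66-1 v2 (2.4) Route B; β sub-cell, BINDER-OWNERS row D1 OWNER `b2b-balaban-beta-an2`, gen 33)

HONEST FRAMING (cell charter, verbatim): «discharging BetaPertH makes Bałaban's UV stability UNCONDITIONAL — a real constructive-QFT result; it is
NOT the continuum limit and NOT the Clay problem.»  HONEST DEPENDENCY: continuum YM on T⁴ ⇐ BetaPertH ∧ nine spine estimates (0/9 proved); BetaPertH
⇐ (D1) ∧ (D4) ∧ CAP+tail; G-an2-4 gates asym, D1 and NE2/3/4.
DERIVED cell leaf ([folklore] kernel algebra over OUR objects).  No statement of Bałaban's papers, no `[cite:]`, no `Prop` fact, no `def`.  WHAT THIS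
ADDS TO THE TREE's `RelInv G_j 𝕄_j symEc` (`RelInvNullShift.relInv_Gsym_bhKStep_add`: `E∘G = G = G∘E`, `(G∘𝕄)∘E = E`, `(E∘𝕄)∘G = E`): the
GENERALISED-INVERSE identity `𝕄∘G∘𝕄 = 𝕄` on the whole live space (so `𝕄∘G`, `G∘𝕄` are the oblique projectors onto `range 𝕄` ∕ `range E`, and
the third inner sandwich-defect word `G X_b 𝕄 (G𝕄 − 1) X_c G` of the second-order remainder vanishes identically — an3 S-an3-g66-1 v2 §2.3–2.4).
ROUTE B (tree names only): `𝕄G𝕄 = 𝕄₀G𝕄₀ + s·𝕄₀G𝔇 + s·𝔇G𝕄₀ + s²·𝔇G𝔇` with `𝕄₀G𝕄₀ = 𝕄₀ ∘ trK Π̂_C = 𝕄₀` (K3-b's `comp_Gsym_bhKStep` + RIGHT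
BLINDNESS `comp_bhKStep_trK_piKSymBm` ∕ `comp_bhK_trK_piKSymBm`, the C-variant differing only on multiplier columns off the coarse lattice where `𝕄₀` is
blind), `𝕄₀G𝔇 = Π̂_C ∘ mfPart 𝔇 = mfPart 𝔇` (`G = G∘E`, `E∘Dsh = mfPart Dsh`), `𝔇G𝕄₀ = fmPart 𝔇 ∘ trK Π̂_C = fmPart 𝔇` (mirror), `𝔇G𝔇 =
fmPart 𝔇 ∘ G ∘ mfPart 𝔇 = 0` ((DG) `(Dsh∘G)_fm = 0`, `SymShiftGaugeBlind`).  HONEST: discharges NO binder of the row by itself; NOT D1, NOT BetaPertH, NOT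
continuum, NOT Clay.  Provenance: β sub-cell, unit beta-an2 gen 33, 2026-08-21 (v1); no existing file touched.
-/

noncomputable section

open Finset
open scoped BigOperators
open Literature.Probability.LatticeModels (Torus.proj)
open Literature.MathematicalPhysics.QuantumFieldTheory
open Literature.MathematicalPhysics.QuantumFieldTheory.Balaban1983to89
open Literature.MathematicalPhysics.QuantumFieldTheory.Balaban1983to89.Beta
open B12Sec2to5 (l1 l1_nonneg)
open ExpKernelCalculus (MKer Decays comp)
open KernelReflection (comp_smul_left comp_smul_right)
open AffineAveraging (Site unitVec box toSite)
open AveragingContours (blk)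
open AveragingContoursRooted (ctr ctrOff ctrOff_mem_box)
open LatticeForm (quo)
open OneStepResolventKernel (Fib)
open Summit.QuantumFields.BalabanUV.Beta.TameKernelCalculus
open Summit.QuantumFields.BalabanUV.Beta.ChartConjugationRelative (spr_comp)
open Summit.QuantumFields.BalabanUV.Beta.AxialDressingRooted (one_le_of_neZero)
open Summit.QuantumFields.BalabanUV.Beta.BorderedHessian (bhK bhK_inl_inr bhK_inr_col_off bhKStep bhKStep_zero bhKStep_succ_inl_inr bhKStep_succ_inr_inr
  spr_bhKStep stepScale)
open Summit.QuantumFields.BalabanUV.Beta.SymmetrisedDressingKernel (piKSymBm piKSymBm_inl_inr piKSymBm_inr_inl piKSymBm_inr_inr)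
open Summit.QuantumFields.BalabanUV.Beta.SymSliceProjectorKernel (symEc trK_symEc)
open Summit.QuantumFields.BalabanUV.Beta.SymSliceProjectorSpread (spr_symEc)
open Summit.QuantumFields.BalabanUV.Beta.SymSliceProjectorRules (piKSymBmC piKSymBmC_inl_inl piKSymBmC_inl_inr piKSymBmC_inr_inl piKSymBmC_inr_inr)
open Summit.QuantumFields.BalabanUV.Beta.SymBorderedHessianBlind (comp_bhK_trK_piKSymBm)
open Summit.QuantumFields.BalabanUV.Beta.SymBorderedHessianStepBlind (comp_bhKStep_trK_piKSymBm)
open Summit.QuantumFields.BalabanUV.Beta.SymmetrisedStepJets (Gsym)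
open Summit.QuantumFields.BalabanUV.Beta.RelInvFactorSandwich (comp_apply' comp_row_eq_zero comp_col_eq_zero spr_Gsym symEc_rules_Gsym comp_Gsym_bhKStep
  comp_bhKStep_Gsym)
open Summit.QuantumFields.BalabanUV.Beta.SymShiftedSpread (bhKStepSh bhKStepSh_apply)
open Summit.QuantumFields.BalabanUV.Beta.DshAn1 (Dsh Dsh_inl_inl Dsh_inr_inr Dsh_inl_inr Dsh_inr_inl Dsh_inr_inl_eq_neg Dsh_inl_inr_eq_sub mfPart fmPart
  trK_mfPart_Dsh trK_Dsh comp_symEc_Dsh spr_Dsh lam04 lam04_eq_zero_of_ne_blk)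
open Summit.QuantumFields.BalabanUV.Beta.SymShiftGaugeBlind (comp_Dsh_Gsym_inl_inr_of_grad)

namespace Summit.QuantumFields.BalabanUV.Beta.SymResolventPseudoInverse

variable {d : ℕ}

/-! ## §1 Block-part bookkeeping -/

section Parts

variable {K : MKer (d + 1) (Fib d)}

/-- [folklore] Entries of `mfPart`. -/
@[simp] theorem mfPart_inr_inl (x y : Fin (d + 1) → ℤ) (m β : Fin (d + 1)) : mfPart K x y (Sum.inr m) (Sum.inl β) = K x y (Sum.inr m) (Sum.inl β) := rfl
/-- [folklore] Entries of `mfPart`. -/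
@[simp] theorem mfPart_inl_inl (x y : Fin (d + 1) → ℤ) (α β : Fin (d + 1)) : mfPart K x y (Sum.inl α) (Sum.inl β) = 0 := rfl
/-- [folklore] Entries of `mfPart`. -/
@[simp] theorem mfPart_inl_inr (x y : Fin (d + 1) → ℤ) (α m : Fin (d + 1)) : mfPart K x y (Sum.inl α) (Sum.inr m) = 0 := rfl
/-- [folklore] Entries of `mfPart`. -/
@[simp] theorem mfPart_inr_inr (x y : Fin (d + 1) → ℤ) (m m' : Fin (d + 1)) : mfPart K x y (Sum.inr m) (Sum.inr m') = 0 := rfl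
/-- [folklore] Entries of `fmPart`. -/
@[simp] theorem fmPart_inl_inr (x y : Fin (d + 1) → ℤ) (α m : Fin (d + 1)) : fmPart K x y (Sum.inl α) (Sum.inr m) = K x y (Sum.inl α) (Sum.inr m) := rfl
/-- [folklore] Entries of `fmPart`. -/
@[simp] theorem fmPart_inl_inl (x y : Fin (d + 1) → ℤ) (α β : Fin (d + 1)) : fmPart K x y (Sum.inl α) (Sum.inl β) = 0 := rfl
/-- [folklore] Entries of `fmPart`. -/
@[simp] theorem fmPart_inr_inl (x y : Fin (d + 1) → ℤ) (m β : Fin (d + 1)) : fmPart K x y (Sum.inr m) (Sum.inl β) = 0 := rfl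
/-- [folklore] Entries of `fmPart`. -/
@[simp] theorem fmPart_inr_inr (x y : Fin (d + 1) → ℤ) (m m' : Fin (d + 1)) : fmPart K x y (Sum.inr m) (Sum.inr m') = 0 := rfl

/-- [folklore] `mfPart` inherits any `Decays` bound. -/
theorem decays_mfPart {C δ : ℝ} (h : Decays K C δ) : Decays (mfPart K) C δ := by
  intro x y a b
  have h0 : (0 : ℝ) ≤ C * Real.exp (-δ * l1 (x - y)) := (abs_nonneg _).trans (h x y a b)
  rcases a with α | m <;> rcases b with β | m'
  · rw [mfPart_inl_inl, abs_zero]; exact h0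
  · rw [mfPart_inl_inr, abs_zero]; exact h0
  · rw [mfPart_inr_inl]; exact h x y _ _
  · rw [mfPart_inr_inr, abs_zero]; exact h0

/-- [folklore] `fmPart` inherits any `Decays` bound. -/
theorem decays_fmPart {C δ : ℝ} (h : Decays K C δ) : Decays (fmPart K) C δ := by
  intro x y a b
  have h0 : (0 : ℝ) ≤ C * Real.exp (-δ * l1 (x - y)) := (abs_nonneg _).trans (h x y a b)
  rcases a with α | m <;> rcases b with β | m'
  · rw [fmPart_inl_inl, abs_zero]; exact h0
  · rw [fmPart_inl_inr]; exact h x y _ _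
  · rw [fmPart_inr_inl, abs_zero]; exact h0
  · rw [fmPart_inr_inr, abs_zero]; exact h0

/-- [folklore] `mfPart` of a spread kernel is spread. -/
theorem spr_mfPart (h : Spr K) : Spr (mfPart K) := by
  obtain ⟨C, δ, hδ, hK⟩ := h
  exact ⟨C, δ, hδ, decays_mfPart hK⟩

/-- [folklore] `fmPart` of a spread kernel is spread. -/
theorem spr_fmPart (h : Spr K) : Spr (fmPart K) := by
  obtain ⟨C, δ, hδ, hK⟩ := h
  exact ⟨C, δ, hδ, decays_fmPart hK⟩

/-- [folklore] A kernel with zero field–field and multiplier–multiplier blocks is the sum of its two border parts. -/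
theorem mfPart_add_fmPart (hff : ∀ x y (α β : Fin (d + 1)), K x y (Sum.inl α) (Sum.inl β) = 0)
    (hmm : ∀ x y (m m' : Fin (d + 1)), K x y (Sum.inr m) (Sum.inr m') = 0) : mfPart K + fmPart K = K := by
  funext x y a b
  rcases a with α | m <;> rcases b with β | m'
  · rw [Pi.add_apply, Pi.add_apply, Pi.add_apply, Pi.add_apply, mfPart_inl_inl, fmPart_inl_inl, hff, add_zero]
  · rw [Pi.add_apply, Pi.add_apply, Pi.add_apply, Pi.add_apply, mfPart_inl_inr, fmPart_inl_inr, zero_add]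
  · rw [Pi.add_apply, Pi.add_apply, Pi.add_apply, Pi.add_apply, mfPart_inr_inl, fmPart_inr_inl, add_zero]
  · rw [Pi.add_apply, Pi.add_apply, Pi.add_apply, Pi.add_apply, mfPart_inr_inr, fmPart_inr_inr, hmm, add_zero]

end Parts

/-! ## §2 The C-variant of right blindness: `𝕄₀ ∘ trK Π̂_C = 𝕄₀`, hence `𝕄₀ ∘ G ∘ 𝕄₀ = 𝕄₀` -/

section Blind

variable {Lc : ℕ} [NeZero Lc]

omit [NeZero Lc] in
/-- [folklore] For a left factor whose multiplier COLUMNS vanish off the coarse lattice, composing with `trK Π̂_C` or with `trK Π̂` is the same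
(the two projector kernels differ only in the multiplier block at non-coarse sites). -/
theorem comp_trK_piKSymBmC_eq (ρ : Fin (d + 1) → ℤ) (N : ℕ) {A : MKer (d + 1) (Fib d)}
    (hA : ∀ (x y : Fin (d + 1) → ℤ) (a : Fib d) (m : Fin (d + 1)), Torus.proj N y ≠ 0 → A x y a (Sum.inr m) = 0) :
    comp A (trK (piKSymBmC ρ N)) = comp A (trK (piKSymBm ρ N)) := by
  funext x z a b
  rw [comp_apply', comp_apply']
  refine tsum_congr fun y => Finset.sum_congr rfl fun f _ => ?_
  rcases f with φ | m' <;> rcases b with β | m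
  · rw [trK_apply, trK_apply, piKSymBmC_inl_inl]
  · rw [trK_apply, trK_apply, piKSymBmC_inr_inl, piKSymBm_inr_inl]
  · rw [trK_apply, trK_apply, piKSymBmC_inl_inr, piKSymBm_inl_inr]
  · rw [trK_apply, trK_apply, piKSymBmC_inr_inr, piKSymBm_inr_inr]
    by_cases hy : Torus.proj N y = 0
    · by_cases h : z = y ∧ m = m'
      · have hz : Torus.proj N z = 0 := by rw [h.1]; exact hy
        rw [if_pos ⟨h.1, h.2, hz⟩, if_pos h]
      · rw [if_neg (fun hh => h ⟨hh.1, hh.2.1⟩), if_neg h]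
    · rw [hA x y a m' hy, zero_mul, zero_mul]

/-- [folklore] The multiplier columns of `bhKStep d Lc j` vanish off the coarse lattice (every `j`). -/
theorem bhKStep_inr_col_off : ∀ (j : ℕ) (x y : Fin (d + 1) → ℤ) (a : Fib d) (m : Fin (d + 1)), Torus.proj Lc y ≠ 0 →
    bhKStep d Lc j x y a (Sum.inr m) = 0
  | 0, x, y, a, m, hy => by rw [bhKStep_zero]; exact bhK_inr_col_off _ hy x a m
  | j + 1, x, y, a, m, hy => by
      rcases a with κ | κ
      · rw [bhKStep_succ_inl_inr, bhK_inl_inr, if_neg hy, mul_zero]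
      · rw [bhKStep_succ_inr_inr]

/-- [folklore] **RIGHT BLINDNESS, C-VARIANT**: `comp (bhKStep d Lc j) (trK (piKSymBmC ρ_c Lc)) = bhKStep d Lc j`, every `j`. -/
theorem comp_bhKStep_trK_piKSymBmC (j : ℕ) : comp (bhKStep d Lc j) (trK (piKSymBmC (ctr (d + 1) Lc) Lc)) = bhKStep d Lc j := by
  have hLc : 1 ≤ Lc := one_le_of_neZero Lc
  rw [comp_trK_piKSymBmC_eq _ _ (bhKStep_inr_col_off (Lc := Lc) j)]
  cases j with
  | zero => rw [bhKStep_zero]; exact comp_bhK_trK_piKSymBm (ctrOff_mem_box hLc)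
  | succ j => exact comp_bhKStep_trK_piKSymBm (ctrOff_mem_box hLc) j

/-- [folklore] **`𝕄₀ ∘ (G ∘ 𝕄₀) = 𝕄₀`** for the straight step spread `𝕄₀ = bhKStep d Lc j` and `G = Gsym Lc j`. -/
theorem comp_bhKStep_Gsym_bhKStep (j : ℕ) : comp (bhKStep d Lc j) (comp (Gsym (d := d) Lc j) (bhKStep d Lc j)) = bhKStep d Lc j := by
  rw [comp_Gsym_bhKStep j]
  exact comp_bhKStep_trK_piKSymBmC j

end Blind

/-! ## §3 The projector kernel fixes the border parts of a coarse-supported shift -/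

section Proj

/-- [folklore] `Π̂_C ∘ mfPart D = mfPart D` when the multiplier rows of `D` live on the coarse lattice. -/
theorem comp_piKSymBmC_mfPart (ρ : Fin (d + 1) → ℤ) (N : ℕ) {D : MKer (d + 1) (Fib d)}
    (hD : ∀ (x y : Fin (d + 1) → ℤ) (m β : Fin (d + 1)), Torus.proj N x ≠ 0 → D x y (Sum.inr m) (Sum.inl β) = 0) :
    comp (piKSymBmC ρ N) (mfPart D) = mfPart D := by
  funext x z a b
  rw [comp_apply']
  rcases b with β | m
  · rcases a with α | m₀
    · -- field row: `Π̂_C`'s field–multiplier entries vanish, `mfPart`'s field rows vanish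
      have h0 : ∀ y (f : Fib d), piKSymBmC ρ N x y (Sum.inl α) f * mfPart D y z f (Sum.inl β) = 0 := fun y f => by
        rcases f with φ | m'
        · rw [mfPart_inl_inl, mul_zero]
        · rw [piKSymBmC_inl_inr, zero_mul]
      rw [mfPart_inl_inl]
      exact (tsum_congr fun y => Finset.sum_eq_zero fun f _ => h0 y f).trans tsum_zero
    · have h0 : ∀ y, ∑ f : Fib d, piKSymBmC ρ N x y (Sum.inr m₀) f * mfPart D y z f (Sum.inl β) =
          if x = y then (if Torus.proj N x = 0 then D y z (Sum.inr m₀) (Sum.inl β) else 0) else 0 := fun y => by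
        rw [Fintype.sum_sum_type]
        have h1 : ∑ φ : Fin (d + 1), piKSymBmC ρ N x y (Sum.inr m₀) (Sum.inl φ) * mfPart D y z (Sum.inl φ) (Sum.inl β) = 0 :=
          Finset.sum_eq_zero fun φ _ => by rw [piKSymBmC_inr_inl, zero_mul]
        rw [h1, zero_add]
        have h2 : ∀ m' : Fin (d + 1), piKSymBmC ρ N x y (Sum.inr m₀) (Sum.inr m') * mfPart D y z (Sum.inr m') (Sum.inl β) =
            if m' = m₀ then (if x = y then (if Torus.proj N x = 0 then D y z (Sum.inr m₀) (Sum.inl β) else 0) else 0) else 0 := fun m' => by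
          rw [piKSymBmC_inr_inr, mfPart_inr_inl]
          by_cases hm : m' = m₀
          · subst hm
            by_cases hxy : x = y
            · by_cases hp : Torus.proj N x = 0
              · rw [if_pos ⟨hxy, rfl, hp⟩, if_pos rfl, if_pos hxy, if_pos hp, one_mul]
              · rw [if_neg (fun h => hp h.2.2), if_pos rfl, if_pos hxy, if_neg hp, zero_mul]
            · rw [if_neg (fun h => hxy h.1), if_pos rfl, if_neg hxy, zero_mul]
          · rw [if_neg (fun h => hm h.2.1.symm), if_neg hm, zero_mul]
        rw [Finset.sum_congr rfl (fun m' _ => h2 m'), Finset.sum_ite_eq' Finset.univ m₀, if_pos (Finset.mem_univ _)]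
      rw [tsum_congr h0, AxialDressingRooted.tsum_point, mfPart_inr_inl]
      by_cases hp : Torus.proj N x = 0
      · rw [if_pos hp]
      · rw [if_neg hp, hD x z m₀ β hp]
  · -- multiplier column of `mfPart D` vanishes
    have h0 : ∀ y (f : Fib d), piKSymBmC ρ N x y a f * mfPart D y z f (Sum.inr m) = 0 := fun y f => by
      rcases f with φ | m'
      · rw [mfPart_inl_inr, mul_zero]
      · rw [mfPart_inr_inr, mul_zero]
    have hz : (∑' y, ∑ f : Fib d, piKSymBmC ρ N x y a f * mfPart D y z f (Sum.inr m)) = 0 :=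
      (tsum_congr fun y => Finset.sum_eq_zero fun f _ => h0 y f).trans tsum_zero
    rw [hz]
    rcases a with α | m₀
    · rw [mfPart_inl_inr]
    · rw [mfPart_inr_inr]

end Proj

/-! ## §4 The double border word vanishes -/

section Double

/-- [folklore] `(fmPart D ∘ G) ∘ mfPart D = 0` once `D` has no field–field block and `(D ∘ G)_fm = 0`. -/
theorem comp_comp_fmPart_mfPart_eq_zero {D G : MKer (d + 1) (Fib d)}
    (hff : ∀ x y (α β : Fin (d + 1)), D x y (Sum.inl α) (Sum.inl β) = 0)
    (hDG : ∀ (x z : Fin (d + 1) → ℤ) (a m : Fin (d + 1)), comp D G x z (Sum.inl a) (Sum.inr m) = 0) :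
    comp (comp (fmPart D) G) (mfPart D) = 0 := by
  -- the multiplier columns of `fmPart D ∘ G` are those of `D ∘ G` on field rows (hence `0`) and `0` on multiplier rows
  have hcol : ∀ (x w : Fin (d + 1) → ℤ) (a : Fib d) (m : Fin (d + 1)), comp (fmPart D) G x w a (Sum.inr m) = 0 := by
    intro x w a m
    rcases a with α | m₀
    · rw [← hDG x w α m, comp_apply', comp_apply']
      refine tsum_congr fun y => Finset.sum_congr rfl fun f _ => ?_
      rcases f with φ | m'
      · rw [fmPart_inl_inl, hff]
      · rw [fmPart_inl_inr]
    · exact comp_row_eq_zero (fun y f => by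
        rcases f with φ | m'
        · rw [fmPart_inr_inl]
        · rw [fmPart_inr_inr]) w _
  funext x z a b
  rw [comp_apply']
  refine (tsum_congr fun w => Finset.sum_eq_zero fun c _ => ?_).trans (by rw [tsum_zero]; rfl)
  rcases c with φ | m
  · rcases b with β | m'
    · rw [mfPart_inl_inl, mul_zero]
    · rw [mfPart_inl_inr, mul_zero]
  · rw [hcol x w a m, zero_mul]

end Double

/-! ## §5 The literal: `𝕄_j ∘ G_j ∘ 𝕄_j = 𝕄_j` -/

section Literal

variable {Lc : ℕ} [NeZero Lc]

omit [NeZero Lc] in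
/-- [folklore] `trK (fmPart Dsh) = −mfPart Dsh` (transpose of `DshAn1.trK_mfPart_Dsh`). -/
theorem trK_fmPart_Dsh : trK (fmPart (Dsh (d := d) Lc)) = -mfPart (Dsh Lc) := by
  have h := congrArg trK (trK_mfPart_Dsh (d := d) Lc)
  rw [trK_trK, trK_neg] at h
  rw [h, neg_neg]

omit [NeZero Lc] in
/-- [folklore] The multiplier rows of `Dsh` live on the coarse lattice. -/
theorem Dsh_inr_inl_off {x : Fin (d + 1) → ℤ} (y : Fin (d + 1) → ℤ) (m β : Fin (d + 1)) (hx : Torus.proj Lc x ≠ 0) :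
    Dsh (d := d) Lc x y (Sum.inr m) (Sum.inl β) = 0 := by
  rw [Dsh_inr_inl, if_neg hx]

omit [NeZero Lc] in
/-- [folklore] `fmPart Dsh ∘ trK Π̂_C = fmPart Dsh` (transpose of §3). -/
theorem comp_fmPart_Dsh_trK_piKSymBmC (ρ : Fin (d + 1) → ℤ) :
    comp (fmPart (Dsh (d := d) Lc)) (trK (piKSymBmC ρ Lc)) = fmPart (Dsh Lc) := by
  have h : trK (comp (fmPart (Dsh (d := d) Lc)) (trK (piKSymBmC ρ Lc))) = trK (fmPart (Dsh (d := d) Lc)) := by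
    rw [trK_comp, trK_trK, trK_fmPart_Dsh, comp_neg_right, comp_piKSymBmC_mfPart ρ Lc (fun x y m β hx => Dsh_inr_inl_off y m β hx)]
  have h' := congrArg trK h
  rwa [trK_trK, trK_trK] at h'

/-- [folklore] `Dsh ∘ symEc = fmPart Dsh` (the transpose of `DshAn1.comp_symEc_Dsh`). -/
theorem comp_Dsh_symEc : comp (Dsh (d := d) Lc) (symEc Lc) = fmPart (Dsh Lc) := by
  have hLc : 1 ≤ Lc := one_le_of_neZero Lc
  have h : trK (comp (Dsh (d := d) Lc) (symEc Lc)) = trK (fmPart (Dsh (d := d) Lc)) := by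
    rw [trK_comp, trK_symEc, trK_Dsh, comp_neg_right, comp_symEc_Dsh hLc, trK_fmPart_Dsh]
  have h' := congrArg trK h
  rwa [trK_trK, trK_trK] at h'

/-- [folklore] (DG) for an1's shift, row form: `(Dsh ∘ G_j)_fm = 0` (`SymShiftGaugeBlind.comp_Dsh_Gsym_inl_inr_of_grad` at (Dff)(Dskew)(Dgrad)). -/
theorem comp_Dsh_Gsym_inl_inr (j : ℕ) (x z : Fin (d + 1) → ℤ) (a m : Fin (d + 1)) :
    comp (Dsh Lc) (Gsym (d := d) Lc j) x z (Sum.inl a) (Sum.inr m) = 0 := by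
  have hLc1 : 1 ≤ Lc := one_le_of_neZero Lc
  have hDff : ∀ (x z : Fin (d + 1) → ℤ) (β β' : Fin (d + 1)), Dsh Lc x z (Sum.inl β) (Sum.inl β') = 0 := fun x z β β' => Dsh_inl_inl Lc x z β β'
  have hDskew : ∀ (x z : Fin (d + 1) → ℤ) (a' m : Fin (d + 1)), Dsh Lc x z (Sum.inl a') (Sum.inr m) = -Dsh Lc z x (Sum.inr m) (Sum.inl a') :=
    fun x z a' m => by rw [Dsh_inr_inl_eq_neg, neg_neg]
  have hDgrad : ∀ (z : Fin (d + 1) → ℤ) (b : Fin (d + 1)), ∃ pot : (Fin (d + 1) → ℤ) → ℝ, (Function.support pot).Finite ∧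
      ∀ (x : Fin (d + 1) → ℤ) (m : Fin (d + 1)), Torus.proj Lc x = 0 →
        Dsh Lc x z (Sum.inr m) (Sum.inl b) = pot (quo Lc x + unitVec m) - pot (quo Lc x) := fun z b =>
    ⟨fun Y => -lam04 Lc b z Y, (Set.finite_singleton (blk Lc z)).subset (fun Y hY => by
        by_contra hne
        apply hY
        show -lam04 Lc b z Y = 0
        rw [lam04_eq_zero_of_ne_blk hLc1 (fun h => hne (Set.mem_singleton_iff.mpr h)), neg_zero]),
      fun x m hx => by rw [Dsh_inr_inl_eq_neg, Dsh_inl_inr_eq_sub, if_pos hx]; ring⟩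
  exact comp_Dsh_Gsym_inl_inr_of_grad hDff hDskew hDgrad j x z a m

/-- **N7g-bis — THE RESOLVENT OF RECORD IS A GENERALISED INVERSE OF THE SHIFTED SPREAD**: for every level `j`,
`comp (bhKStepSh d Lc (Dsh Lc) j) (comp (Gsym Lc j) (bhKStepSh d Lc (Dsh Lc) j)) = bhKStepSh d Lc (Dsh Lc) j` — `𝕄_j G_j 𝕄_j = 𝕄_j`. [folklore] -/
theorem comp_bhKStepSh_Gsym_bhKStepSh (j : ℕ) :
    comp (bhKStepSh d Lc (Dsh Lc) j) (comp (Gsym (d := d) Lc j) (bhKStepSh d Lc (Dsh Lc) j)) = bhKStepSh d Lc (Dsh Lc) j := by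
  have hLc : 1 ≤ Lc := one_le_of_neZero Lc
  -- tameness of the letters
  have sM0 : Spr (bhKStep d Lc j) := spr_bhKStep (d := d) (Lc := Lc) j
  have tM0 : Tame (bhKStep d Lc j) := sM0.tame
  have sG : Spr (Gsym (d := d) Lc j) := spr_Gsym (d := d) (Lc := Lc) j
  have tG : Tame (Gsym (d := d) Lc j) := sG.tame
  have sD : Spr (Dsh (d := d) Lc) := spr_Dsh (d := d) hLc
  have tD : Tame (Dsh (d := d) Lc) := sD.tame
  have tE : Tame (symEc (d := d) Lc) := (spr_symEc (d := d) hLc).tame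
  have tmf : Tame (mfPart (Dsh (d := d) Lc)) := (spr_mfPart sD).tame
  have tfm : Tame (fmPart (Dsh (d := d) Lc)) := (spr_fmPart sD).tame
  have tsD : Tame (stepScale d Lc j • Dsh (d := d) Lc) := (RelInvNullShift.spr_smul _ sD).tame
  have tGM0 : Tame (comp (Gsym (d := d) Lc j) (bhKStep d Lc j)) := (spr_comp sG sM0).tame
  have tsGD : Tame (stepScale d Lc j • comp (Gsym (d := d) Lc j) (Dsh Lc)) := (RelInvNullShift.spr_smul _ (spr_comp sG sD)).tame
  have tX : Tame (comp (Gsym (d := d) Lc j) (bhKStep d Lc j) + stepScale d Lc j • comp (Gsym (d := d) Lc j) (Dsh Lc)) :=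
    (RelInvNullShift.spr_add (spr_comp sG sM0) (RelInvNullShift.spr_smul _ (spr_comp sG sD))).tame
  -- the relative rules `G∘E = G`, `E∘G = G`; `E∘D = mfPart D`, `D∘E = fmPart D`
  have hGE : comp (Gsym (d := d) Lc j) (symEc Lc) = Gsym Lc j := (symEc_rules_Gsym (d := d) (Lc := Lc) j).2
  have hEG : comp (symEc Lc) (Gsym (d := d) Lc j) = Gsym Lc j := (symEc_rules_Gsym (d := d) (Lc := Lc) j).1
  have hED : comp (symEc Lc) (Dsh (d := d) Lc) = mfPart (Dsh Lc) := comp_symEc_Dsh hLc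
  have hDE : comp (Dsh (d := d) Lc) (symEc Lc) = fmPart (Dsh Lc) := comp_Dsh_symEc
  -- `G∘D = G∘mfPart D` and `D∘G = fmPart D∘G`
  have hGD : comp (Gsym (d := d) Lc j) (Dsh Lc) = comp (Gsym (d := d) Lc j) (mfPart (Dsh Lc)) := by
    rw [← hED, comp_assoc_tame tG tE tD, hGE]
  have hDG : comp (Dsh Lc) (Gsym (d := d) Lc j) = comp (fmPart (Dsh Lc)) (Gsym (d := d) Lc j) := by
    rw [← hDE, ← comp_assoc_tame tD tE tG, hEG]
  -- (i) `𝕄₀ G 𝕄₀ = 𝕄₀`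
  have h1 : comp (bhKStep d Lc j) (comp (Gsym (d := d) Lc j) (bhKStep d Lc j)) = bhKStep d Lc j := comp_bhKStep_Gsym_bhKStep j
  -- (ii) `𝕄₀ G D = mfPart D`
  have h2 : comp (bhKStep d Lc j) (comp (Gsym (d := d) Lc j) (Dsh Lc)) = mfPart (Dsh Lc) := by
    rw [hGD, comp_assoc_tame tM0 tG tmf, comp_bhKStep_Gsym j]
    exact comp_piKSymBmC_mfPart _ _ (fun x y m β hx => Dsh_inr_inl_off y m β hx)
  -- (iii) `D G 𝕄₀ = fmPart D`
  have h3 : comp (Dsh Lc) (comp (Gsym (d := d) Lc j) (bhKStep d Lc j)) = fmPart (Dsh Lc) := by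
    rw [comp_assoc_tame tD tG tM0, hDG, ← comp_assoc_tame tfm tG tM0, comp_Gsym_bhKStep j]
    exact comp_fmPart_Dsh_trK_piKSymBmC _
  -- (iv) `D G D = 0`
  have h4 : comp (Dsh Lc) (comp (Gsym (d := d) Lc j) (Dsh Lc)) = 0 := by
    rw [hGD, comp_assoc_tame tD tG tmf, hDG]
    exact comp_comp_fmPart_mfPart_eq_zero (fun x y α β => Dsh_inl_inl Lc x y α β) (fun x z a m => comp_Dsh_Gsym_inl_inr j x z a m)
  -- assemble
  have hsum : mfPart (Dsh (d := d) Lc) + fmPart (Dsh Lc) = Dsh Lc :=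
    mfPart_add_fmPart (fun x y α β => Dsh_inl_inl Lc x y α β) (fun x y m m' => Dsh_inr_inr Lc x y m m')
  calc comp (bhKStepSh d Lc (Dsh Lc) j) (comp (Gsym (d := d) Lc j) (bhKStepSh d Lc (Dsh Lc) j))
      = comp (bhKStep d Lc j + stepScale d Lc j • Dsh Lc) (comp (Gsym (d := d) Lc j) (bhKStep d Lc j + stepScale d Lc j • Dsh Lc)) := by
          rw [bhKStepSh_apply]
    _ = comp (bhKStep d Lc j + stepScale d Lc j • Dsh Lc)
          (comp (Gsym (d := d) Lc j) (bhKStep d Lc j) + stepScale d Lc j • comp (Gsym (d := d) Lc j) (Dsh Lc)) := by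
          rw [comp_add_right_tame tG tM0 tsD, KernelReflection.comp_smul_right]
    _ = comp (bhKStep d Lc j) (comp (Gsym (d := d) Lc j) (bhKStep d Lc j) + stepScale d Lc j • comp (Gsym (d := d) Lc j) (Dsh Lc))
          + stepScale d Lc j • comp (Dsh Lc) (comp (Gsym (d := d) Lc j) (bhKStep d Lc j) + stepScale d Lc j • comp (Gsym (d := d) Lc j) (Dsh Lc)) := by
          rw [comp_add_left_tame tM0 tsD tX, KernelReflection.comp_smul_left]
    _ = (comp (bhKStep d Lc j) (comp (Gsym (d := d) Lc j) (bhKStep d Lc j)) + stepScale d Lc j • comp (bhKStep d Lc j) (comp (Gsym (d := d) Lc j) (Dsh Lc)))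
          + stepScale d Lc j • (comp (Dsh Lc) (comp (Gsym (d := d) Lc j) (bhKStep d Lc j))
              + stepScale d Lc j • comp (Dsh Lc) (comp (Gsym (d := d) Lc j) (Dsh Lc))) := by
          rw [comp_add_right_tame tM0 tGM0 tsGD, KernelReflection.comp_smul_right, comp_add_right_tame tD tGM0 tsGD, KernelReflection.comp_smul_right]
    _ = (bhKStep d Lc j + stepScale d Lc j • mfPart (Dsh Lc)) + stepScale d Lc j • (fmPart (Dsh Lc) + stepScale d Lc j • (0 : MKer (d + 1) (Fib d))) := by
          rw [h1, h2, h3, h4]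
    _ = bhKStepSh d Lc (Dsh Lc) j := by
          rw [smul_zero, add_zero, add_assoc, ← smul_add, hsum, bhKStepSh_apply]

/-- [folklore] Corollary: `𝕄_j ∘ (G_j ∘ 𝕄_j − G_j ∘ 𝕄_j ∘ … )` — the defect `𝕄_j − 𝕄_j G_j 𝕄_j` VANISHES (an3's `𝕄° = 0`; the third inner
sandwich-defect word `G X 𝕄 (G𝕄 − 1) X′ G = G C_X 𝕄° C_{X′} G` of the second-order remainder is therefore `0`). -/
theorem bhKStepSh_sub_sandwich_eq_zero (j : ℕ) :
    bhKStepSh d Lc (Dsh Lc) j - comp (bhKStepSh d Lc (Dsh Lc) j) (comp (Gsym (d := d) Lc j) (bhKStepSh d Lc (Dsh Lc) j)) = 0 := by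
  rw [comp_bhKStepSh_Gsym_bhKStepSh j, sub_self]

end Literal

end Summit.QuantumFields.BalabanUV.Beta.SymResolventPseudoInverse

end
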